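import Mathlib
import HarnessLib

/-!
# (iso-succ) PART A — the graded lemma: `G ^ ν ∣ F` with `F` weighted-homogeneous of degree `w i · ν` containing the monomial `X i ^ ν`
# forces `F = c · G ^ ν` and `G = a · X i + φ` (door `HypersurfaceCentreConstruction`, stmt-ResolutionOfSingularities-19897; P3 rung
# `stub_keyRungLE_three`, skeleton v3.8; ORDER (o42)(1) of res-L1-w43-plan-1 — res-type-073 leads (PARTS B, C in `…Iota3IsoSucc.lean`),
# res-type-061 pairs on PART A)

Topic: `Summits/ResolutionOfSingularities/ResolutionOfSingularities/Theorems`.  DEF-FREE, Mathlib-only.  The pure commutative-algebra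
half of the (iso-succ) lemma of ORDER (o42) («every successor position over 𝔪 with ν′ = ν is, in the orbit space, an ISOLATED position»):
in the weighted polynomial ring `k[X_j : j ∈ σ]` (weights `w : σ → ℕ`, all positive) over a field `k`, let `F` be weighted-homogeneous of
degree `w i · ν` (`0 < ν`) with the pure power `X i ^ ν` occurring in `F`, and let `G` be weighted-homogeneous of positive degree with
`G ^ ν ∣ F`.  Then `F = C c * G ^ ν` for a non-zero scalar `c`, and `G = C a * X i + φ` with `a ≠ 0`, `φ` free of `X i` and
weighted-homogeneous of degree `w i` (so `G` has degree `w i` and `X i`-degree `1`).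

Proof: single out the variable `i` (`optionEquivLeft ∘ rename (Equiv.optionSubtypeNe i).symm`, an algebra isomorphism onto
`Polynomial (MvPolynomial {j // j ≠ i} k)`); positivity of the weights and homogeneity give `natDegree = ν` with leading coefficient the
CONSTANT `C (F.coeff (X i ^ ν))`, a unit; in the domain `Polynomial (MvPolynomial _ k)` the factorisation `F = G ^ ν · H` multiplies
`natDegree`s and leading coefficients, so `ν · natDegree G ≤ ν`, both leading coefficients are units (= non-zero constants, the ring being
reduced), `natDegree G = 0` contradicts the positive degree of `G`, and `natDegree G = 1` gives `H = C h`, `G = C a · Y + C b`.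

* `Iota3.eq_C_mul_pow_of_pow_dvd` — the general form (any index type `σ`, any positive weights, any variable `i`);
* `Iota3.eq_C_mul_pow_of_pow_dvd_fin3` — res-type-073's instance: `σ = Fin 3`, `w = ![q, r₂, r₁]` (`0 < q ≤ r₂ ≤ r₁`), `i = 2`, i.e. the
  orientation `(x̄, ḡ₂, ḡ₁) = (X 0, X 1, X 2)` of `PointDropOf` / `P3bDropOf` (`u = ![x, g₂, g₁]`, `w = ![q, r₂, r₁]`) and of res-type-070's
  bridge `flagContactFiltration_eq_weightedMonomialIdeal`.

[folklore commutative algebra (degree and leading-coefficient count in `R[Y]` over a domain); OUR bookkeeping for OUR (o42) lemma; nothing here is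
a statement about Hironaka's problem or of the manuscript under review (Hironaka 2017, [claim: Hironaka2017, status: under-review]); AI
formalisation, weaker than expert review.]
-/

open MvPolynomial

set_option linter.dupNamespace false -- mandated namespace of this single-conjunct summit

namespace Summit.ResolutionOfSingularities.ResolutionOfSingularities.Cruxes.HypersurfaceCentreConstruction.LocalEngine

namespace Iota3

section IsoSuccGraded

variable {k : Type} [Field k] {σ : Type} [DecidableEq σ]

/-! ## Bookkeeping: weights, and the variable `i` singled out -/

omit [DecidableEq σ] in
/-- `weight w f = f s · w s + weight w (f.erase s)`. [folklore] -/
theorem weight_eq_mul_add_weight_erase (w : σ → ℕ) (f : σ →₀ ℕ) (s : σ) :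
    Finsupp.weight w f = f s * w s + Finsupp.weight w (f.erase s) := by
  conv_lhs => rw [← Finsupp.single_add_erase s f]
  rw [map_add, Finsupp.weight_single, smul_eq_mul]

/-- The `natDegree` in the singled-out variable `i` is the `X i`-degree. [folklore] -/
theorem natDegree_optionEquivLeft_rename (i : σ) (P : MvPolynomial σ k) :
    (optionEquivLeft k {j // j ≠ i} (rename (Equiv.optionSubtypeNe i).symm P)).natDegree = P.degreeOf i := by
  rw [natDegree_optionEquivLeft]
  have h := degreeOf_rename_of_injective (p := P) (Equiv.optionSubtypeNe i).symm.injective i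
  rwa [Equiv.optionSubtypeNe_symm_self] at h

/-- The multi-index of `σ` with `i ↦ m` and `j ↦ d j` off `i`. [folklore] -/
theorem mapDomain_optionElim_apply_self (i : σ) (m : ℕ) (d : {j // j ≠ i} →₀ ℕ) :
    ((d.optionElim m).mapDomain (Equiv.optionSubtypeNe i)) i = m := by
  have h := Finsupp.mapDomain_apply (Equiv.optionSubtypeNe i).injective (d.optionElim m) none
  rwa [Equiv.optionSubtypeNe_none, Finsupp.optionElim_apply_none] at h

/-- The multi-index of `σ` with `i ↦ m` and `j ↦ d j` off `i`, evaluated off `i`. [folklore] -/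
theorem mapDomain_optionElim_apply_coe (i : σ) (m : ℕ) (d : {j // j ≠ i} →₀ ℕ) (j : {j // j ≠ i}) :
    ((d.optionElim m).mapDomain (Equiv.optionSubtypeNe i)) j = d j := by
  have h := Finsupp.mapDomain_apply (Equiv.optionSubtypeNe i).injective (d.optionElim m) (some j)
  rwa [Equiv.optionSubtypeNe_some, Finsupp.optionElim_apply_some] at h

/-- Coefficients after singling out `i`: the `d`-coefficient of the `Y ^ m`-coefficient is the coefficient of `F` at the multi-index
`i ↦ m`, `j ↦ d j`. [folklore] -/
theorem coeff_coeff_optionEquivLeft_rename (i : σ) (P : MvPolynomial σ k) (m : ℕ) (d : {j // j ≠ i} →₀ ℕ) :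
    ((optionEquivLeft k {j // j ≠ i} (rename (Equiv.optionSubtypeNe i).symm P)).coeff m).coeff d =
      P.coeff ((d.optionElim m).mapDomain (Equiv.optionSubtypeNe i)) := by
  rw [optionEquivLeft_coeff_coeff]
  have h : d.optionElim m =
      (((d.optionElim m).mapDomain (Equiv.optionSubtypeNe i)).mapDomain (Equiv.optionSubtypeNe i).symm) := by
    rw [← Finsupp.mapDomain_comp, Equiv.symm_comp_self, Finsupp.mapDomain_id]
  conv_lhs => rw [h]
  rw [coeff_rename_mapDomain _ (Equiv.optionSubtypeNe i).symm.injective]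

/-- With `i ↦ m` and nothing else, the multi-index is `single i m`. [folklore] -/
theorem mapDomain_optionElim_zero (i : σ) (m : ℕ) :
    ((0 : {j // j ≠ i} →₀ ℕ).optionElim m).mapDomain (Equiv.optionSubtypeNe i) = Finsupp.single i m := by
  rw [Finsupp.optionElim_zero, Finsupp.mapDomain_single, Equiv.optionSubtypeNe_none]

/-- Singling out `i` is injective. [folklore] -/
theorem optionEquivLeft_rename_injective (i : σ) :
    Function.Injective fun P : MvPolynomial σ k =>
      optionEquivLeft k {j // j ≠ i} (rename (Equiv.optionSubtypeNe i).symm P) :=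
  (optionEquivLeft k {j // j ≠ i}).injective.comp (rename_injective _ (Equiv.optionSubtypeNe i).symm.injective)

/-- Singling out `i` sends `X i` to `Y`. [folklore] -/
theorem optionEquivLeft_rename_X_self (i : σ) :
    optionEquivLeft k {j // j ≠ i} (rename (Equiv.optionSubtypeNe i).symm (X i : MvPolynomial σ k)) = Polynomial.X := by
  rw [rename_X, Equiv.optionSubtypeNe_symm_self, optionEquivLeft_X_none]

/-- Singling out `i` sends `C c` to `C (C c)`. [folklore] -/
theorem optionEquivLeft_rename_C (i : σ) (c : k) :
    optionEquivLeft k {j // j ≠ i} (rename (Equiv.optionSubtypeNe i).symm (C c : MvPolynomial σ k)) = Polynomial.C (C c) := by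
  rw [rename_C, optionEquivLeft_C]

/-- Undoing the singling out. [folklore] -/
theorem optionEquivLeft_rename_rename_symm (i : σ) (P : Polynomial (MvPolynomial {j // j ≠ i} k)) :
    optionEquivLeft k {j // j ≠ i} (rename (Equiv.optionSubtypeNe i).symm
      (rename (Equiv.optionSubtypeNe i) ((optionEquivLeft k {j // j ≠ i}).symm P))) = P := by
  rw [rename_rename, Equiv.symm_comp_self, rename_id, AlgHom.id_apply, AlgEquiv.apply_symm_apply]

/-! ## Homogeneity and positive weights: the `X i`-degree and the leading coefficient -/

omit [DecidableEq σ] in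
/-- A weighted-homogeneous `F` of degree `w i · ν` (positive weights) has `X i`-degree `≤ ν`. [folklore] -/
theorem degreeOf_le_of_isWeightedHomogeneous (w : σ → ℕ) (hw : ∀ j, 0 < w j) (i : σ) {ν : ℕ} {F : MvPolynomial σ k}
    (hF : F.IsWeightedHomogeneous w (w i * ν)) : F.degreeOf i ≤ ν := by
  rw [degreeOf_le_iff]
  intro m hm
  have hwt : Finsupp.weight w m = w i * ν := hF (mem_support_iff.mp hm)
  have hle : m i * w i ≤ Finsupp.weight w m := by
    rw [weight_eq_mul_add_weight_erase w m i]; exact Nat.le_add_right _ _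
  rw [hwt, mul_comm (w i)] at hle
  exact Nat.le_of_mul_le_mul_right hle (hw i)

/-- A weighted-homogeneous `F` of degree `w i · ν` (positive weights): after singling out `i`, the `Y ^ ν`-coefficient is the CONSTANT
`C (F.coeff (X i ^ ν))`. [folklore] -/
theorem coeff_optionEquivLeft_rename_eq_C (w : σ → ℕ) (hw : ∀ j, 0 < w j) (i : σ) {ν : ℕ} {F : MvPolynomial σ k}
    (hF : F.IsWeightedHomogeneous w (w i * ν)) :
    (optionEquivLeft k {j // j ≠ i} (rename (Equiv.optionSubtypeNe i).symm F)).coeff ν = C (F.coeff (Finsupp.single i ν)) := by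
  ext d
  rw [coeff_coeff_optionEquivLeft_rename, coeff_C]
  split_ifs with hd
  · rw [← hd, mapDomain_optionElim_zero]
  · -- `d ≠ 0`: the multi-index has weight `> w i · ν`
    have hd' : d ≠ 0 := fun h => hd h.symm
    obtain ⟨j, hj⟩ := Finsupp.ne_iff.mp hd'
    rw [Finsupp.zero_apply] at hj
    refine hF.coeff_eq_zero _ (ne_of_gt ?_)
    rw [weight_eq_mul_add_weight_erase w _ i, mapDomain_optionElim_apply_self, mul_comm]
    refine Nat.lt_add_of_pos_right (lt_of_lt_of_le (hw j) (Finsupp.le_weight_of_ne_zero' (w := w) ?_))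
    rw [Finsupp.erase_ne j.2, mapDomain_optionElim_apply_coe]
    exact hj

/-! ## The graded lemma -/

/-- **(iso-succ) PART A, general form.**  `k` a field, `w : σ → ℕ` positive weights, `i : σ`, `0 < ν`; `F` weighted-homogeneous of degree
`w i · ν` with `F.coeff (X i ^ ν) ≠ 0`; `G` weighted-homogeneous of positive degree `d` with `G ^ ν ∣ F`.  Then there are non-zero scalars
`c, a` and a polynomial `φ` with `F = C c * G ^ ν`, `G = C a * X i + φ`, `φ` free of `X i` (`φ.degreeOf i = 0`), `G.degreeOf i = 1`, `φ`
weighted-homogeneous of degree `w i`, and `d = w i`. [folklore commutative algebra · OUR (o42) bookkeeping] -/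
theorem eq_C_mul_pow_of_pow_dvd (w : σ → ℕ) (hw : ∀ j, 0 < w j) (i : σ) {ν : ℕ} (hν : 0 < ν)
    {F G : MvPolynomial σ k} (hF : F.IsWeightedHomogeneous w (w i * ν)) (hFi : F.coeff (Finsupp.single i ν) ≠ 0)
    {d : ℕ} (hG : G.IsWeightedHomogeneous w d) (hd : 0 < d) (hdvd : G ^ ν ∣ F) :
    ∃ (c a : k) (φ : MvPolynomial σ k), c ≠ 0 ∧ a ≠ 0 ∧ F = C c * G ^ ν ∧ G = C a * X i + φ ∧
      φ.degreeOf i = 0 ∧ G.degreeOf i = 1 ∧ φ.IsWeightedHomogeneous w (w i) ∧ d = w i := by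
  obtain ⟨H, hFGH⟩ := hdvd
  have hF0 : F ≠ 0 := fun h => hFi (by rw [h, coeff_zero])
  have hG0 : G ≠ 0 := by rintro rfl; exact hF0 (by rw [hFGH, zero_pow hν.ne', zero_mul])
  have hH0 : H ≠ 0 := by rintro rfl; exact hF0 (by rw [hFGH, mul_zero])
  -- single out the variable `i`
  set e : MvPolynomial σ k → Polynomial (MvPolynomial {j // j ≠ i} k) :=
    fun P => optionEquivLeft k {j // j ≠ i} (rename (Equiv.optionSubtypeNe i).symm P) with he
  have he_inj : Function.Injective e := optionEquivLeft_rename_injective i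
  have he_mul : ∀ P Q, e (P * Q) = e P * e Q := fun P Q => by simp only [he, map_mul]
  have he_pow : ∀ P (n : ℕ), e (P ^ n) = e P ^ n := fun P n => by simp only [he, map_pow]
  have he_add : ∀ P Q, e (P + Q) = e P + e Q := fun P Q => by simp only [he, map_add]
  have he_C : ∀ c : k, e (C c) = Polynomial.C (C c) := fun c => optionEquivLeft_rename_C i c
  have he_X : e (X i) = Polynomial.X := optionEquivLeft_rename_X_self i
  have he_nat : ∀ P, (e P).natDegree = P.degreeOf i := natDegree_optionEquivLeft_rename i
  have he_zero : e 0 = 0 := by simp only [he, map_zero]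
  have he0 : ∀ {P}, P ≠ 0 → e P ≠ 0 := fun hP h => hP (he_inj (by rw [h, he_zero]))
  -- `F`: `natDegree = ν`, leading coefficient `C c₀`
  have hcoF : (e F).coeff ν = C (F.coeff (Finsupp.single i ν)) := coeff_optionEquivLeft_rename_eq_C w hw i hF
  have hnatF : (e F).natDegree = ν := by
    refine le_antisymm ?_ (Polynomial.le_natDegree_of_ne_zero ?_)
    · rw [he_nat]; exact degreeOf_le_of_isWeightedHomogeneous w hw i hF
    · rw [hcoF]; exact fun h => hFi (C_eq_zero.mp h)
  have hlcF : (e F).leadingCoeff = C (F.coeff (Finsupp.single i ν)) := by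
    rw [← Polynomial.coeff_natDegree, hnatF, hcoF]
  -- the factorisation, read in `Polynomial (MvPolynomial _ k)` (a domain)
  have heF : e F = e G ^ ν * e H := by rw [hFGH, he_mul, he_pow]
  have heG0 : e G ≠ 0 := he0 hG0
  have heH0 : e H ≠ 0 := he0 hH0
  have hnat : ν * (e G).natDegree + (e H).natDegree = ν := by
    have h1 := congrArg Polynomial.natDegree heF
    rw [hnatF, Polynomial.natDegree_mul (pow_ne_zero _ heG0) heH0, Polynomial.natDegree_pow] at h1
    exact h1.symm
  have hlc : (e G).leadingCoeff ^ ν * (e H).leadingCoeff = C (F.coeff (Finsupp.single i ν)) := by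
    have h1 := congrArg Polynomial.leadingCoeff heF
    rw [hlcF, Polynomial.leadingCoeff_mul, Polynomial.leadingCoeff_pow] at h1
    exact h1.symm
  have hunit : IsUnit ((e G).leadingCoeff ^ ν * (e H).leadingCoeff) := by
    rw [hlc]; exact (isUnit_iff_ne_zero.mpr hFi).map C
  rw [IsUnit.mul_iff, isUnit_pow_iff hν.ne'] at hunit
  obtain ⟨a, ha, haG⟩ := isUnit_iff_eq_C_of_isReduced.mp hunit.1
  obtain ⟨h, hh, hhH⟩ := isUnit_iff_eq_C_of_isReduced.mp hunit.2
  have ha0 : a ≠ 0 := ha.ne_zero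
  have hh0 : h ≠ 0 := hh.ne_zero
  -- `natDegree (e G) ≤ 1`
  have hnG : (e G).natDegree ≤ 1 := by
    by_contra hcon
    have h2 : ν * 2 ≤ ν * (e G).natDegree := Nat.mul_le_mul_left ν (by omega)
    omega
  rcases Nat.le_one_iff_eq_zero_or_eq_one.mp hnG with hnG0 | hnG1
  · -- `natDegree (e G) = 0`: `G = C a`, a unit — contradicts `0 < d`
    exfalso
    have hGC : G = C a := by
      apply he_inj
      rw [he_C, Polynomial.eq_C_of_natDegree_eq_zero hnG0, ← haG, ← Polynomial.coeff_natDegree, hnG0]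
    have h0 : Finsupp.weight w (0 : σ →₀ ℕ) = d := hG (d := 0) (by rw [hGC, coeff_C, if_pos rfl]; exact ha0)
    rw [map_zero] at h0
    exact hd.ne h0
  · -- `natDegree (e G) = 1`: `H = C h`, `G = C a · Y + C b`
    have hnH : (e H).natDegree = 0 := by rw [hnG1] at hnat; omega
    have hHC : H = C h := by
      apply he_inj
      rw [he_C, Polynomial.eq_C_of_natDegree_eq_zero hnH]
      rw [← hhH, ← Polynomial.coeff_natDegree, hnH]
    set b : MvPolynomial {j // j ≠ i} k := (e G).coeff 0 with hb
    set φ : MvPolynomial σ k :=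
      rename (Equiv.optionSubtypeNe i) ((optionEquivLeft k {j // j ≠ i}).symm (Polynomial.C b)) with hφ
    have heφ : e φ = Polynomial.C b := optionEquivLeft_rename_rename_symm i _
    have hGe : G = C a * X i + φ := by
      apply he_inj
      rw [he_add, he_mul, he_C, he_X, heφ, Polynomial.eq_X_add_C_of_natDegree_le_one hnG, ← hb]
      rw [← haG, ← Polynomial.coeff_natDegree, hnG1]
    have hφdeg : φ.degreeOf i = 0 := by rw [← he_nat, heφ, Polynomial.natDegree_C]
    have hGdeg : G.degreeOf i = 1 := by rw [← he_nat, hnG1]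
    have hFe : F = C h * G ^ ν := by
      rw [hFGH, hHC, mul_comm]
    -- the coefficient of `X i` in `G` is `a`, so `d = w i`
    have hφi : φ.coeff (Finsupp.single i 1) = 0 := by
      by_contra hne
      have h1 := monomial_le_degreeOf i (mem_support_iff.mpr hne)
      rw [hφdeg, Finsupp.single_eq_same] at h1
      exact Nat.not_succ_le_zero 0 h1
    have hGi : G.coeff (Finsupp.single i 1) = a := by
      rw [hGe, coeff_add, coeff_C_mul, hφi, add_zero, coeff_X, if_pos rfl, mul_one]
    have hdw : d = w i := by
      have h1 : Finsupp.weight w (Finsupp.single i 1) = d := hG (by rw [hGi]; exact ha0)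
      rw [Finsupp.weight_single, one_smul] at h1
      exact h1.symm
    have hφhom : φ.IsWeightedHomogeneous w (w i) := by
      have hφ' : φ = G - C a * X i := by rw [hGe]; ring
      rw [hφ', ← mem_weightedHomogeneousSubmodule]
      refine Submodule.sub_mem _ ?_ ?_
      · rw [mem_weightedHomogeneousSubmodule, ← hdw]; exact hG
      · rw [mem_weightedHomogeneousSubmodule]; exact (isWeightedHomogeneous_X k w i).C_mul a
    exact ⟨h, a, φ, hh0, ha0, hFe, hGe, hφdeg, hGdeg, hφhom, hdw⟩

end IsoSuccGraded

/-! ## res-type-073's instance: `σ = Fin 3`, `w = ![q, r₂, r₁]`, `i = 2` -/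

/-- **(iso-succ) PART A in the orientation of `PointDropOf` / `P3bDropOf` and res-type-070's bridge**: variables `(x̄, ḡ₂, ḡ₁) = (X 0, X 1, X 2)`,
weights `![q, r₂, r₁]` with `0 < q ≤ r₂ ≤ r₁`, `0 < ν`; `F` (the weighted initial form `in_w f`) weighted-homogeneous of degree `r₁ · ν` with
`F.coeff (ḡ₁ ^ ν) ≠ 0`; `G` weighted-homogeneous of positive degree with `G ^ ν ∣ F`.  Then `F = C c * G ^ ν` (`c ≠ 0`), `G.degreeOf 2 = 1`,
and `G = C a * X 2 + φ` with `a ≠ 0`, `φ` free of `ḡ₁` and weighted-homogeneous of degree `r₁` (and the degree of `G` is `r₁`).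
[folklore commutative algebra · OUR (o42) bookkeeping] -/
theorem eq_C_mul_pow_of_pow_dvd_fin3 {k : Type} [Field k] {q r₂ r₁ ν : ℕ} (hq : 0 < q) (hq₂ : q ≤ r₂) (h₂₁ : r₂ ≤ r₁) (hν : 0 < ν)
    {F G : MvPolynomial (Fin 3) k} (hF : F.IsWeightedHomogeneous ![q, r₂, r₁] (r₁ * ν))
    (hFi : F.coeff (Finsupp.single 2 ν) ≠ 0) {d : ℕ} (hG : G.IsWeightedHomogeneous ![q, r₂, r₁] d) (hd : 0 < d)
    (hdvd : G ^ ν ∣ F) :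
    ∃ c : k, c ≠ 0 ∧ F = C c * G ^ ν ∧ G.degreeOf 2 = 1 ∧
      ∃ (a : k) (φ : MvPolynomial (Fin 3) k), a ≠ 0 ∧ G = C a * X 2 + φ ∧ φ.degreeOf 2 = 0 ∧
        φ.IsWeightedHomogeneous ![q, r₂, r₁] r₁ ∧ d = r₁ := by
  have hw : ∀ j : Fin 3, 0 < (![q, r₂, r₁] : Fin 3 → ℕ) j := by
    intro j
    fin_cases j
    · exact hq
    · exact lt_of_lt_of_le hq hq₂
    · exact lt_of_lt_of_le hq (hq₂.trans h₂₁)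
  obtain ⟨c, a, φ, hc, ha, hFe, hGe, hφdeg, hGdeg, hφhom, hdw⟩ :=
    eq_C_mul_pow_of_pow_dvd (k := k) ![q, r₂, r₁] hw 2 hν (F := F) (G := G) hF hFi hG hd hdvd
  exact ⟨c, hc, hFe, hGdeg, a, φ, ha, hGe, hφdeg, hφhom, hdw⟩

end Iota3

end Summit.ResolutionOfSingularities.ResolutionOfSingularities.Cruxes.HypersurfaceCentreConstruction.LocalEngine
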